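import Literature.Geometry.Lorentzian.KerrObstructionOuterLayer
import HarnessLib

/-!
# The cokernel pairing of Li–Mei's obstruction is nondegenerate

Support file (all results proved; no named facts) for the named fact `LiMei.interiorKerrGluing`
(`InteriorKerrGluing.lean`; J. Li, H. Mei, *A construction of collapsing spacetimes in vacuum*,
Comm. Math. Phys. 378 (2020) = arXiv:2005.01249, Prop. 4.1), Steps S3/S5 of the architecture in
`InteriorKerrGluingReduction.lean`. In the Corvino–Schoen step (Li–Mei p. 24) the correction
`(h, ω)` solves the constraint equations on the shell *modulo the cokernel*: the momentum constraint
of the corrected datum is `ζ Σᵢ cᵢ G₀(Xᵢ, ·)` for the four Schwarzschild-cylinder KID fields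
`X₀ = ∂_t♭ = dirVec`, `Xᵢ = eᵢ × y` (all with zero lapse component: `∂_t` and the rotations are
tangent to the cylinder `{r = r₀}` inside the black hole) and a bump `ζ`. "It suffices to show
`𝓘 = 0`" (p. 25) is the statement that the pairing of this cokernel with the four obstruction
integrals is nondegenerate. This file proves it:

* `LiMei.kidVec c y = c.1 • dirVec y + c.2 × y`, `crossVec_add_left`, `crossVec_smul_left`,
  `crossVec_eq_sum`, `kidVec_inner_self`;
* `LiMei.eq_zero_of_kidVec_eq_zero_on` — a combination of the four KID fields vanishing on a
  nonempty open set is trivial;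
* **`LiMei.eq_zero_of_weighted_pairings_eq_zero`** — for a continuous weight `w ≥ 0` supported in
  a shell `{s₁ ≤ ‖y‖ ≤ s₂}` (`1 < s₁`) and positive somewhere, if
  `∫ w G₀(V_c, X) dy = 0` for the four fields `X` (`G₀` the Schwarzschild cylinder metric,
  `V_c = kidVec c`), then `c = 0` (the Gram form `∫ w G₀(V_c, V_c) ≥ 0` vanishes, `G₀` is positive
  definite by `gbarRep_pos`).

## References

* J. Li, H. Mei, arXiv:2005.01249, §4, proof of Prop. 4.1, pp. 24–25. [LiMei2020]
* J. Corvino, R. Schoen, *On the asymptotics for the vacuum Einstein constraint equations*,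
  J. Differential Geom. 73 (2006), §3 (the projected problem and the cokernel pairing).
-/

noncomputable section

open Set Filter Function Metric MeasureTheory ContinuousLinearMap
open scoped Topology RealInnerProductSpace Real Manifold ContDiff

namespace Literature.Geometry.Lorentzian

namespace LiMei

open MetricCoord

attribute [local instance] instNormedAddCommGroupBilinE3 instNormedSpaceBilinE3

/-! ### The four KID fields and their combinations -/

/-- The combination `c.1 ∂_t♭ + c.2 × y` of the four Schwarzschild-cylinder KID fields.
[cite: LiMei2020, proof of Prop. 4.1, p. 24] -/
def kidVec (c : ℝ × E3) (y : E3) : E3 := c.1 • dirVec y + crossVec c.2 y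

/-- `ω × y` is additive in `ω`. [folklore] -/
theorem crossVec_add_left (ξ ξ' y : E3) : crossVec (ξ + ξ') y = crossVec ξ y + crossVec ξ' y := by
  ext i
  fin_cases i <;>
    simp [crossVec_apply_zero, crossVec_apply_one, crossVec_apply_two] <;> ring

/-- `ω × y` is homogeneous in `ω`. [folklore] -/
theorem crossVec_smul_left (c : ℝ) (ξ y : E3) : crossVec (c • ξ) y = c • crossVec ξ y := by
  ext i
  fin_cases i <;>
    simp [crossVec_apply_zero, crossVec_apply_one, crossVec_apply_two] <;> ring

/-- `ω × y = Σᵢ ωᵢ (eᵢ × y)`. [folklore] -/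
theorem crossVec_eq_sum (ξ y : E3) :
    crossVec ξ y = ∑ i : Fin 3, ξ i • crossVec (EuclideanSpace.single i 1) y := by
  ext j
  fin_cases j <;>
    simp [crossVec_apply_zero, crossVec_apply_one, crossVec_apply_two, Fin.sum_univ_three] <;> ring

/-- `eᵢ × y` read off componentwise: `e₀ × y = (0, -y₂, y₁)` etc., used through `crossVec_apply_*`.
`⟪V_c(y), y⟫ = c.1 ‖y‖`. [folklore] -/
theorem kidVec_inner_self (c : ℝ × E3) (y : E3) : ⟪kidVec c y, y⟫ = c.1 * ‖y‖ := by
  rw [kidVec, inner_add_left, inner_smul_left, inner_crossVec_right_self, add_zero, dirVec,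
    inner_smul_left, real_inner_self_eq_norm_sq]
  simp only [conj_trivial]
  rcases eq_or_ne y 0 with rfl | hy
  · simp
  · have hn : ‖y‖ ≠ 0 := norm_ne_zero_iff.2 hy
    field_simp

/-- `ω × u = 0` for all `u` forces `ω = 0`. [folklore] -/
theorem eq_zero_of_crossVec_eq_zero {ξ : E3} (h : ∀ u : E3, crossVec ξ u = 0) : ξ = 0 := by
  have h0 := h (EuclideanSpace.single 0 1)
  have h1 := h (EuclideanSpace.single 1 1)
  have e1 : ξ 1 = 0 := by
    have := congrArg (fun v : E3 ↦ v 2) h0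
    simpa [crossVec_apply_two] using this
  have e2 : ξ 2 = 0 := by
    have := congrArg (fun v : E3 ↦ v 1) h0
    simpa [crossVec_apply_one] using this
  have e0 : ξ 0 = 0 := by
    have := congrArg (fun v : E3 ↦ v 2) h1
    simpa [crossVec_apply_two] using this
  ext i
  fin_cases i <;> simp [e0, e1, e2]

/-- **A combination of the four KID fields vanishing on a nonempty open set is trivial.**
[cite: LiMei2020, proof of Prop. 4.1, p. 24] -/
theorem eq_zero_of_kidVec_eq_zero_on {c : ℝ × E3} {O : Set E3} (hO : IsOpen O) {y₀ : E3}
    (hy₀ : y₀ ∈ O) (hy₀0 : y₀ ≠ 0) (h : ∀ y ∈ O, kidVec c y = 0) : c = 0 := by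
  -- the radial coefficient
  have h1 : c.1 = 0 := by
    have e := congrArg (fun v : E3 ↦ ⟪v, y₀⟫) (h y₀ hy₀)
    simp only [kidVec_inner_self, inner_zero_left] at e
    exact (mul_eq_zero.1 e).resolve_right (norm_ne_zero_iff.2 hy₀0)
  -- the rotational coefficient: `c.2 × y = 0` on `O`, hence on all vectors by linearity
  have hcross : ∀ y ∈ O, crossVec c.2 y = 0 := fun y hy ↦ by
    have e := h y hy
    rwa [kidVec, h1, zero_smul, zero_add] at e
  obtain ⟨r, hr, hball⟩ := Metric.isOpen_iff.1 hO y₀ hy₀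
  have hall : ∀ u : E3, crossVec c.2 u = 0 := by
    intro u
    set t : ℝ := r / 2 / (‖u‖ + 1) with ht
    have ht0 : 0 < t := by positivity
    have hmem : y₀ + t • u ∈ O := by
      refine hball ?_
      rw [mem_ball, dist_eq_norm, add_sub_cancel_left, norm_smul, Real.norm_eq_abs, abs_of_pos ht0,
        ht]
      have hu : 0 < ‖u‖ + 1 := by positivity
      rw [div_mul_eq_mul_div, div_lt_iff₀ hu]
      nlinarith [norm_nonneg u]
    have e := hcross _ hmem
    rw [← crossCLM_apply, map_add, map_smul, crossCLM_apply, crossCLM_apply, hcross y₀ hy₀, zero_add,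
      smul_eq_zero] at e
    exact e.resolve_left ht0.ne'
  exact Prod.ext h1 (eq_zero_of_crossVec_eq_zero hall)

/-! ### The weighted Gram form -/

section Gram

variable [Kerr.Facts] {M r₀ : ℝ}

omit [Kerr.Facts] in
/-- `G₀(V_c, Z)` expanded along the four fields. [folklore] -/
theorem cylH_kidVec_left (τ₀ : ℝ) (R₀ : E3 →ₗᵢ[ℝ] E3) (c : ℝ × E3) (y Z : E3) :
    cylH M 0 r₀ τ₀ R₀ y (kidVec c y) Z =
      c.1 * cylH M 0 r₀ τ₀ R₀ y (dirVec y) Z +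
        ∑ i : Fin 3, c.2 i * cylH M 0 r₀ τ₀ R₀ y (crossVec (EuclideanSpace.single i 1) y) Z := by
  rw [kidVec, map_add, map_smul, add_apply, smul_apply, smul_eq_mul, crossVec_eq_sum, map_sum,
    sum_apply]
  simp only [map_smul, smul_apply, smul_eq_mul]

omit [Kerr.Facts] in
/-- Continuity of the weighted pairing integrands: the weight kills the singularity of `dirVec` at
the origin. [folklore] -/
theorem continuous_weighted_pairing (hr₀ : 0 < r₀) (τ₀ : ℝ) (R₀ : E3 →ₗᵢ[ℝ] E3) {s₁ : ℝ}
    (hs₁ : 1 < s₁) {w : E3 → ℝ} (hwc : Continuous w) (hws : ∀ y, w y ≠ 0 → s₁ ≤ ‖y‖)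
    {V X : E3 → E3} (hV : ContinuousOn V {y : E3 | 1 < ‖y‖}) (hX : ContinuousOn X {y : E3 | 1 < ‖y‖}) :
    Continuous fun y ↦ w y * cylH M 0 r₀ τ₀ R₀ y (V y) (X y) := by
  refine continuous_iff_continuousAt.2 fun y ↦ ?_
  by_cases hy : 1 < ‖y‖
  · have hn : {z : E3 | 1 < ‖z‖} ∈ 𝓝 y := (isOpen_lt continuous_const continuous_norm).mem_nhds hy
    have hG : ContinuousAt (cylH M 0 r₀ τ₀ R₀) y := (continuous_cylH hr₀ M 0 τ₀ R₀).continuousAt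
    exact hwc.continuousAt.mul ((hG.clm_apply (hV.continuousAt hn)).clm_apply (hX.continuousAt hn))
  · -- `w` vanishes on the open set `{‖z‖ < s₁} ∋ y`
    have hys : ‖y‖ < s₁ := lt_of_le_of_lt (le_of_not_gt hy) hs₁
    have hn : {z : E3 | ‖z‖ < s₁} ∈ 𝓝 y := (isOpen_lt continuous_norm continuous_const).mem_nhds hys
    have hev : (fun z ↦ w z * cylH M 0 r₀ τ₀ R₀ z (V z) (X z)) =ᶠ[𝓝 y] fun _ ↦ 0 := by
      filter_upwards [hn] with z hz
      have hw : w z = 0 := by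
        by_contra h
        exact absurd (hws z h) (not_le.2 hz)
      rw [hw, zero_mul]
    exact (continuousAt_const.congr hev.symm)

omit [Kerr.Facts] in
/-- `dirVec` is continuous off the origin. [folklore] -/
theorem continuousOn_dirVec : ContinuousOn dirVec {y : E3 | 1 < ‖y‖} := by
  intro y hy
  have hy0 : y ≠ 0 := by rintro rfl; simp at hy; linarith
  have h : ContinuousAt (fun z : E3 ↦ ‖z‖⁻¹ • z) y :=
    ((continuous_norm.continuousAt).inv₀ (norm_ne_zero_iff.2 hy0)).smul continuousAt_id
  exact h.continuousWithinAt

omit [Kerr.Facts] in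
/-- `kidVec c` is continuous off the origin. [folklore] -/
theorem continuousOn_kidVec (c : ℝ × E3) : ContinuousOn (kidVec c) {y : E3 | 1 < ‖y‖} :=
  (continuousOn_dirVec.const_smul c.1).add (crossCLM c.2).continuous.continuousOn

/-- **Nondegeneracy of the cokernel pairing.** Let `w` be a continuous nonnegative weight
supported in `{s₁ ≤ ‖y‖}` (`1 < s₁`) with compact support, positive at some point, and
`G₀ = H[M, 0]` the Schwarzschild cylinder metric (`0 < r₀ < 2M`). If the weighted pairings of
`V_c = c.1 ∂_t♭ + c.2 × y` with the four KID fields vanish,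
`∫ w G₀(V_c, ∂_t♭) = 0` and `∫ w G₀(V_c, eᵢ × y) = 0` (`i = 1, 2, 3`), then `c = 0`.
[cite: LiMei2020, proof of Prop. 4.1, pp. 24–25] -/
theorem eq_zero_of_weighted_pairings_eq_zero (hr₀ : 0 < r₀) (h2M : r₀ < 2 * M) (τ₀ : ℝ)
    (R₀ : E3 →ₗᵢ[ℝ] E3) {s₁ : ℝ} (hs₁ : 1 < s₁) {w : E3 → ℝ} (hwc : Continuous w)
    (hw0 : ∀ y, 0 ≤ w y) (hws : ∀ y, w y ≠ 0 → s₁ ≤ ‖y‖) (hwK : HasCompactSupport w) {y₀ : E3}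
    (hy₀ : 0 < w y₀) (c : ℝ × E3)
    (hI₀ : ∫ y, w y * cylH M 0 r₀ τ₀ R₀ y (kidVec c y) (dirVec y) = 0)
    (hI : ∀ i : Fin 3,
      ∫ y, w y * cylH M 0 r₀ τ₀ R₀ y (kidVec c y) (crossVec (EuclideanSpace.single i 1) y) = 0) :
    c = 0 := by
  -- the integrands and their integrability
  set g : E3 → ℝ := fun y ↦ w y * cylH M 0 r₀ τ₀ R₀ y (kidVec c y) (kidVec c y) with hg
  have hcX : ∀ i : Fin 3, ContinuousOn (fun y ↦ crossVec (EuclideanSpace.single i 1) y)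
      {y : E3 | 1 < ‖y‖} := fun i ↦ (crossCLM _).continuous.continuousOn
  have hgc : Continuous g :=
    continuous_weighted_pairing hr₀ τ₀ R₀ hs₁ hwc hws (continuousOn_kidVec c) (continuousOn_kidVec c)
  have hsupp : ∀ {V X : E3 → E3}, HasCompactSupport fun y ↦ w y * cylH M 0 r₀ τ₀ R₀ y (V y) (X y) :=
    fun {V X} ↦ hwK.mul_right
  have hint : ∀ {V X : E3 → E3}, ContinuousOn V {y : E3 | 1 < ‖y‖} →
      ContinuousOn X {y : E3 | 1 < ‖y‖} →
      Integrable fun y ↦ w y * cylH M 0 r₀ τ₀ R₀ y (V y) (X y) := fun hV hX ↦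
    (continuous_weighted_pairing hr₀ τ₀ R₀ hs₁ hwc hws hV hX).integrable_of_hasCompactSupport hsupp
  -- the Gram form vanishes
  have hsplit : ∀ y, g y = c.1 * (w y * cylH M 0 r₀ τ₀ R₀ y (kidVec c y) (dirVec y)) +
      ∑ i : Fin 3, c.2 i * (w y * cylH M 0 r₀ τ₀ R₀ y (kidVec c y)
        (crossVec (EuclideanSpace.single i 1) y)) := by
    intro y
    have hsym : cylH M 0 r₀ τ₀ R₀ y (kidVec c y) (kidVec c y) =
        c.1 * cylH M 0 r₀ τ₀ R₀ y (kidVec c y) (dirVec y) +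
          ∑ i : Fin 3, c.2 i * cylH M 0 r₀ τ₀ R₀ y (kidVec c y)
            (crossVec (EuclideanSpace.single i 1) y) := by
      have h := cylH_kidVec_left (M := M) (r₀ := r₀) τ₀ R₀ c y (kidVec c y)
      have hG := isMetricOn_cylH_zero_spin hr₀ h2M τ₀ R₀
      by_cases hy : 1 < ‖y‖
      · rw [hG.symm y hy] at h
        rw [h]
        congr 1
        · rw [hG.symm y hy]
        · exact Finset.sum_congr rfl fun i _ ↦ by rw [hG.symm y hy]
      · -- both sides are multiplied by `w y = 0` below; but we prove the identity via symmetry of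
        -- `cylH` at all points (it is a symmetric form everywhere)
        rw [(isMetricOn_cylH (admissible_zero_spin hr₀ h2M).1 (admissible_zero_spin hr₀ h2M).2.1
          (admissible_zero_spin hr₀ h2M).2.2 τ₀ R₀).symm y (mem_univ _)] at h
        rw [h]
        congr 1
        · rw [(isMetricOn_cylH (admissible_zero_spin hr₀ h2M).1 (admissible_zero_spin hr₀ h2M).2.1
            (admissible_zero_spin hr₀ h2M).2.2 τ₀ R₀).symm y (mem_univ _)]
        · exact Finset.sum_congr rfl fun i _ ↦ by
            rw [(isMetricOn_cylH (admissible_zero_spin hr₀ h2M).1 (admissible_zero_spin hr₀ h2M).2.1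
              (admissible_zero_spin hr₀ h2M).2.2 τ₀ R₀).symm y (mem_univ _)]
    change w y * cylH M 0 r₀ τ₀ R₀ y (kidVec c y) (kidVec c y) = _
    rw [hsym, mul_add, Finset.mul_sum]
    congr 1
    · ring
    · exact Finset.sum_congr rfl fun i _ ↦ by ring
  have hQ : ∫ y, g y = 0 := by
    simp_rw [hsplit]
    rw [integral_add ((hint (continuousOn_kidVec c) continuousOn_dirVec).const_mul _)
      (integrable_finsetSum _ fun i _ ↦ (hint (continuousOn_kidVec c) (hcX i)).const_mul _),
      integral_const_mul, integral_finsetSum _ fun i _ ↦ (hint (continuousOn_kidVec c) (hcX i)).const_mul _,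
      hI₀, mul_zero, zero_add]
    refine Finset.sum_eq_zero fun i _ ↦ ?_
    rw [integral_const_mul, hI i, mul_zero]
  -- nonnegativity and vanishing of the Gram integrand
  have hg0 : ∀ y, 0 ≤ g y := by
    intro y
    by_cases hw : w y = 0
    · rw [hg]; simp [hw]
    · have hy1 : 1 ≤ ‖y‖ := (le_of_lt hs₁).trans (hws y hw)
      have hy0 : y ≠ 0 := by rintro rfl; rw [norm_zero] at hy1; linarith
      rw [hg]
      refine mul_nonneg (hw0 y) ?_
      rw [cylH_zero_spin_apply hr₀ τ₀ R₀ hy1]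
      rcases eq_or_ne (kidVec c y) 0 with h0 | h0
      · rw [h0, gbarRep]; simp
      · exact (gbarRep_pos hr₀ h2M hy0 h0).le
  have hgi : Integrable g := hgc.integrable_of_hasCompactSupport hwK.mul_right
  have hae : g =ᵐ[volume] 0 := (integral_eq_zero_iff_of_nonneg (fun y ↦ hg0 y) hgi).1 hQ
  have hzero : g = 0 := (hgc.ae_eq_iff_eq volume continuous_const).1 hae
  -- the positive set of the weight
  set O : Set E3 := {y | 0 < w y} with hO_def
  have hO : IsOpen O := isOpen_lt continuous_const hwc
  have hy₀1 : 1 < ‖y₀‖ := lt_of_lt_of_le hs₁ (hws y₀ hy₀.ne')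
  have hy₀0 : y₀ ≠ 0 := by rintro rfl; rw [norm_zero] at hy₀1; linarith
  refine eq_zero_of_kidVec_eq_zero_on hO (show y₀ ∈ O from hy₀) hy₀0 fun y hy ↦ ?_
  have hy1 : 1 ≤ ‖y‖ := (le_of_lt hs₁).trans (hws y (ne_of_gt hy))
  have hy0 : y ≠ 0 := by rintro rfl; rw [norm_zero] at hy1; linarith
  have e := congrFun hzero y
  simp only [hg, Pi.zero_apply, mul_eq_zero] at e
  rcases e with e | e
  · exact absurd e (ne_of_gt hy)
  · by_contra hV
    have hp := gbarRep_pos hr₀ h2M hy0 hV (M := M)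
    rw [cylH_zero_spin_apply hr₀ τ₀ R₀ hy1] at e
    linarith

end Gram

end LiMei

end Literature.Geometry.Lorentzian

end
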